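import Summits.CriticalPhenomena.PercolationContinuityZ3.Theorems.PercNearOneGluingNoHeavyConstsClusterSquareQuadClash
import Summits.CriticalPhenomena.PercolationContinuityZ3.Theorems.PercNearOneGluingNoHeavyConstsClusterSquareSeparated
import HarnessLib

/-!
# No quadruple clash behind a gate vertex: `K₂,ₘ` at every placement, wheels through the hub, …

builds on p205010 (kernel theorem, internal audit signed; external expert review pending)

PAPER-2 track "percolation constants", part (ii), seat `prim-consts-1`, gen 18 (lane index
`run/shared/lean/prim/consts/CONSTANTS.md`, row A19; memo `FROM-prim-consts-1-g18-QUAD-CLASH.md` §0(3)).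
Support file for the crux `NoHeavyLowerTail` (stmt-CriticalPhenomena-4575; `--supports`).  Theorems only; no sorries.

A quadruple clash at `K = C_a(ω)` (`…ConstsClusterSquareQuadClash.lean`) needs in particular a DOUBLE TOUCH in `ω` alone: a vertex
`y ∈ C_b(ω)` and a vertex `y' ∈ C_c(ω)`, both outside `{b, c}` and both joined to `K` by positive pairs — i.e. two vertex-disjoint open
paths `b ⇝ y`, `c ⇝ y'` in `H − K` ending at distinct boundary vertices of `K` (`H` ⊇ positive pairs).  By Menger's theorem this is
impossible exactly when ONE vertex `v` separates `{b, c}` from the boundary `N'(K) = N(K) ∖ {b, c}` in `H − K`; as a certificate: a set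
`S` containing `b` (if `b ≠ v`) and `c` (if `c ≠ v`), closed under `H`-steps into vertices outside `K ∪ {v}`, and containing no vertex of
`N'(K)` (`Consts.not_quadClash_of_gate`, which also accepts, cluster by cluster, the "at most three boundary vertices" alternative of
`…ConstsClusterSquareQuadClashBoundary.lean`).  CSQ, DUU at `(a; b, c)` and TS for `{a, b, c}` follow (`…_of_gate`).
Examples.  `K₂,ₘ` (poles `p₁, p₂`) at EVERY placement and every `m`: with `a` in the `m`-part, `K = {a}` has two boundary vertices and
every other cluster `K ∋ pᵢ` has the gate `v = p_{3−i}` (resp. no boundary at all); with `a = p₁`, every `K` has the gate `p₂`.  Wheels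
`W_n` rooted on the rim with the hub a terminal (`K` = a rim arc, boundary ⊆ {hub, two rim vertices}).  Every graph in which `b` and `c`
reach the rest of the graph only through a common cut vertex.
References: N. Gladkov, arXiv:2408.08457v2 (2024), Thm. 4.3, Def. 4.2, Lemma 3.1, Example 2.5, Thm. 5.2; K. Menger (1927) (motivation only).
-/

noncomputable section

open Classical

namespace Summit.CriticalPhenomena.PercolationContinuityZ3.Theorems

open MeasureTheory Finset Literature.Probability.LatticeModels Literature.Probability.Percolation
open Literature.Probability.Percolation.DecisionTree Literature.Probability.Percolation.BHK2006
open Literature.Probability.Percolation.TargetExploration Literature.Probability.Percolation.ClusterConditioning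

namespace Consts

section General

variable {V : Type*}

/-- **No quadruple clash behind a gate.**  `H` carries the positive pairs.  Suppose that for every `K ∋ a` with `b, c ∉ K`, `H`-connected
from `a` (every `T ∋ a` closed under `H`-steps into `K` contains `K`), EITHER no four pairwise distinct vertices outside `K` have
`H`-neighbours in `K`, OR there are a vertex `v` and a set `S` with `b ∈ S` unless `b = v`, `c ∈ S` unless `c = v`, `S` closed under
`H`-steps into vertices outside `K ∪ {v}`, and no vertex of `S` other than `b, c` adjacent (in `H`) to `K`.  Then the no-quad-clash
hypothesis of `Consts.clusterSquare_le_sq_of_noQuadClash_pos` holds (indeed not even a double touch `y ∈ C_b(ω) ∩ N'(K)`,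
`y' ∈ C_c(ω) ∩ N'(K)` occurs behind a gate). [folklore (Menger); input for Gladkov2024, Thm. 4.3] -/
theorem not_quadClash_of_gate (H : SimpleGraph V) (w : Sym2 V → unitInterval) {a b c : V}
    (hH : ∀ u v, u ≠ v → (0 : ℝ) < w s(u, v) → H.Adj u v)
    (hK : ∀ (K : Set V), a ∈ K → b ∉ K → c ∉ K →
      (∀ T : Set V, a ∈ T → (∀ u x, u ∈ T → H.Adj u x → x ∈ K → x ∈ T) → K ⊆ T) →
      (∀ v₁ v₂ v₃ v₄ : V, v₁ ∉ K → v₂ ∉ K → v₃ ∉ K → v₄ ∉ K →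
          (∃ k, k ∈ K ∧ H.Adj k v₁) → (∃ k, k ∈ K ∧ H.Adj k v₂) → (∃ k, k ∈ K ∧ H.Adj k v₃) → (∃ k, k ∈ K ∧ H.Adj k v₄) →
          v₁ ≠ v₂ → v₁ ≠ v₃ → v₁ ≠ v₄ → v₂ ≠ v₃ → v₂ ≠ v₄ → v₃ ≠ v₄ → False) ∨
      (∃ (v : V) (S : Set V), (b ≠ v → b ∈ S) ∧ (c ≠ v → c ∈ S) ∧
          (∀ u x, u ∈ S → H.Adj u x → x ∉ K → x ≠ v → x ∈ S) ∧
          (∀ y, y ∈ S → y ≠ b → y ≠ c → (∃ k, k ∈ K ∧ H.Adj k y) → False)))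
    {ω η : Set (Sym2 V)} (hω : ∀ e ∈ ω, (0 : ℝ) < w e) (_hη : ∀ e ∈ η, (0 : ℝ) < w e)
    (hab : ¬ (openGraph ω).Reachable a b) (hac : ¬ (openGraph ω).Reachable a c) (hbc : ¬ (openGraph ω).Reachable b c)
    (hbc' : ¬ (openGraph (η \ barOf {a} (setCl ω {a}))).Reachable b c) :
    ¬ ((∃ y k : V, (openGraph ω).Reachable a k ∧ (0 : ℝ) < w s(k, y) ∧ (openGraph ω).Reachable b y ∧
          (openGraph (η \ barOf {a} (setCl ω {a}))).Reachable c y) ∧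
       (∃ y k : V, (openGraph ω).Reachable a k ∧ (0 : ℝ) < w s(k, y) ∧ (openGraph ω).Reachable c y ∧
          (openGraph (η \ barOf {a} (setCl ω {a}))).Reachable b y) ∧
       (∃ y k : V, (openGraph ω).Reachable a k ∧ (0 : ℝ) < w s(k, y) ∧ (openGraph ω).Reachable b y ∧
          (openGraph (η \ barOf {a} (setCl ω {a}))).Reachable b y) ∧
       (∃ y k : V, (openGraph ω).Reachable a k ∧ (0 : ℝ) < w s(k, y) ∧ (openGraph ω).Reachable c y ∧
          (openGraph (η \ barOf {a} (setCl ω {a}))).Reachable c y)) := by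
  rintro ⟨⟨y, k, hk, hw, hby, hcy⟩, ⟨y', k', hk', hw', hcy', hby'⟩, ⟨z, l, hl, hwz, hbz, hbz'⟩, ⟨z', l', hl', hwz', hcz, hcz'⟩⟩
  set θ := η \ barOf {a} (setCl ω {a}) with hθdef
  set K : Set V := {x | (openGraph ω).Reachable a x} with hKdef
  have hadjH : ∀ (ξ : Set (Sym2 V)), (∀ e ∈ ξ, (0 : ℝ) < w e) → ∀ u v, (openGraph ξ).Adj u v → H.Adj u v := by
    intro ξ hξ u v huv
    rw [openGraph_adj] at huv
    exact hH u v huv.2 (hξ _ huv.1)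
  have hconn : ∀ T : Set V, a ∈ T → (∀ u x, u ∈ T → H.Adj u x → x ∈ K → x ∈ T) → K ⊆ T := by
    intro T haT hT x hx
    obtain ⟨X⟩ := id hx
    exact mem_of_openWalk_adm H T (fun z => z ∈ K) (fun u z hu huz hz => hT u z hu huz hz) (hadjH ω hω) X haT
      fun z hz => Or.inr (show (openGraph ω).Reachable a z from ⟨X.takeUntil z hz⟩)
  have hadj : ∀ {q v : V}, (openGraph ω).Reachable a q → (0 : ℝ) < w s(q, v) → v ∉ K → ∃ k, k ∈ K ∧ H.Adj k v :=
    fun {q v} hq hqv hv => ⟨q, hq, hH q v (fun h => hv (h ▸ hq)) hqv⟩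
  have hyK : y ∉ K := fun h => hab (h.trans hby.symm)
  have hyK' : y' ∉ K := fun h => hac (h.trans hcy'.symm)
  have hzK : z ∉ K := fun h => hab (h.trans hbz.symm)
  have hzK' : z' ∉ K := fun h => hac (h.trans hcz.symm)
  rcases hK K (SimpleGraph.Reachable.refl a) hab hac hconn with hfour | ⟨v, S, hbS, hcS, hcl, hSN⟩
  · -- at most three boundary vertices: the four clash vertices are distinct boundary vertices
    exact hfour y y' z z' hyK hyK' hzK hzK' (hadj hk hw hyK) (hadj hk' hw' hyK') (hadj hl hwz hzK) (hadj hl' hwz' hzK')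
      (fun h => hbc (hby.trans (by rw [h]; exact hcy'.symm)))
      (fun h => hbc' (hbz'.trans (by rw [← h]; exact hcy.symm)))
      (fun h => hbc (hby.trans (by rw [h]; exact hcz.symm)))
      (fun h => hbc (hbz.trans (by rw [← h]; exact hcy'.symm)))
      (fun h => hbc' (hby'.trans (by rw [h]; exact hcz'.symm)))
      (fun h => hbc (hbz.trans (by rw [h]; exact hcz.symm)))
  · -- a gate `v`: the `ω`-path to `y` (inside `C_b(ω)`) or the `ω`-path to `y'` (inside `C_c(ω)`) avoids `v`
    have hyb : y ≠ b := fun h => hbc' (by rw [← h]; exact hcy.symm)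
    have hyc : y ≠ c := fun h => hbc (by rw [← h]; exact hby)
    have hy'b : y' ≠ b := fun h => hbc (by rw [h] at hcy'; exact hcy'.symm)
    have hy'c : y' ≠ c := fun h => hbc' (by rw [h] at hby'; exact hby')
    have hωx : ∀ {s t : V} (X : (openGraph ω).Walk s t) (x : V), x ∈ X.support → (openGraph ω).Reachable s x :=
      fun X x hx => ⟨X.takeUntil x hx⟩
    by_cases hvb : (openGraph ω).Reachable b v
    · -- `v ∈ C_b(ω)`, so the path `c ⇝ y'` avoids `v`
      have hcv : c ≠ v := fun h => hbc (by rw [h]; exact hvb)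
      obtain ⟨X⟩ := hcy'
      refine hSN y' (mem_of_openWalk_adm H S (fun x => x ∉ K ∧ x ≠ v)
        (fun u x hu hux hx => hcl u x hu hux hx.1 hx.2) (hadjH ω hω) X (hcS hcv) fun x hx => Or.inr ?_) hy'b hy'c
        (hadj hk' hw' hyK')
      have hcx : (openGraph ω).Reachable c x := hωx X x hx
      exact ⟨fun h => hac (h.trans hcx.symm), fun h => hbc (hvb.trans (by rw [← h]; exact hcx.symm))⟩
    · -- `v ∉ C_b(ω)`, so the path `b ⇝ y` avoids `v`
      have hbv : b ≠ v := fun h => hvb (by rw [h])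
      obtain ⟨X⟩ := hby
      refine hSN y (mem_of_openWalk_adm H S (fun x => x ∉ K ∧ x ≠ v)
        (fun u x hu hux hx => hcl u x hu hux hx.1 hx.2) (hadjH ω hω) X (hbS hbv) fun x hx => Or.inr ?_) hyb hyc
        (hadj hk hw hyK)
      have hbx : (openGraph ω).Reachable b x := hωx X x hx
      exact ⟨fun h => hab (h.trans hbx.symm), fun h => hvb (by rw [← h]; exact hbx)⟩

end General

/-! ### `Fin n` forms -/

/-- **TS for `{a, b, c}` when every cluster of `a` avoiding `b, c` has at most three boundary vertices or a gate vertex**: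
`μ(a|b|c)² ≤ μ(a↮b)·μ(a↮c)·μ(b↮c)`.  Instances: `K₂,ₘ` at every placement (all `m`), wheels rooted on the rim with the hub a terminal.
[cite: Gladkov2024, Thm. 4.3 and Thm. 5.2; derived here] -/
theorem tripleSplit_of_gate {n : ℕ} (w : Sym2 (Fin n) → unitInterval) (a b c : Fin n) (H : SimpleGraph (Fin n))
    (hH : ∀ u v, u ≠ v → (0 : ℝ) < w s(u, v) → H.Adj u v)
    (hK : ∀ (K : Set (Fin n)), a ∈ K → b ∉ K → c ∉ K →
      (∀ T : Set (Fin n), a ∈ T → (∀ u x, u ∈ T → H.Adj u x → x ∈ K → x ∈ T) → K ⊆ T) →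
      (∀ v₁ v₂ v₃ v₄ : Fin n, v₁ ∉ K → v₂ ∉ K → v₃ ∉ K → v₄ ∉ K →
          (∃ k, k ∈ K ∧ H.Adj k v₁) → (∃ k, k ∈ K ∧ H.Adj k v₂) → (∃ k, k ∈ K ∧ H.Adj k v₃) → (∃ k, k ∈ K ∧ H.Adj k v₄) →
          v₁ ≠ v₂ → v₁ ≠ v₃ → v₁ ≠ v₄ → v₂ ≠ v₃ → v₂ ≠ v₄ → v₃ ≠ v₄ → False) ∨
      (∃ (v : Fin n) (S : Set (Fin n)), (b ≠ v → b ∈ S) ∧ (c ≠ v → c ∈ S) ∧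
          (∀ u x, u ∈ S → H.Adj u x → x ∉ K → x ≠ v → x ∈ S) ∧
          (∀ y, y ∈ S → y ≠ b → y ≠ c → (∃ k, k ∈ K ∧ H.Adj k y) → False))) :
    (prodBernoulli w).real ((openConn a b)ᶜ ∩ (openConn a c)ᶜ ∩ (openConn b c)ᶜ) ^ 2 ≤
      (prodBernoulli w).real (openConn a b)ᶜ * (prodBernoulli w).real (openConn a c)ᶜ *
        (prodBernoulli w).real (openConn b c)ᶜ :=
  tripleSplit_of_noQuadClash_pos w a b c fun _ _ hω hη hab hac hbc hbc' =>
    not_quadClash_of_gate H w hH hK hω hη hab hac hbc hbc'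

/-- **CSQ at `(a; b, c)` under the same hypothesis.** [cite: Gladkov2024, Thm. 4.3; derived here] -/
theorem clusterSquare_le_sq_of_gate {n : ℕ} (w : Sym2 (Fin n) → unitInterval) (a b c : Fin n) (H : SimpleGraph (Fin n))
    (hH : ∀ u v, u ≠ v → (0 : ℝ) < w s(u, v) → H.Adj u v)
    (hK : ∀ (K : Set (Fin n)), a ∈ K → b ∉ K → c ∉ K →
      (∀ T : Set (Fin n), a ∈ T → (∀ u x, u ∈ T → H.Adj u x → x ∈ K → x ∈ T) → K ⊆ T) →
      (∀ v₁ v₂ v₃ v₄ : Fin n, v₁ ∉ K → v₂ ∉ K → v₃ ∉ K → v₄ ∉ K →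
          (∃ k, k ∈ K ∧ H.Adj k v₁) → (∃ k, k ∈ K ∧ H.Adj k v₂) → (∃ k, k ∈ K ∧ H.Adj k v₃) → (∃ k, k ∈ K ∧ H.Adj k v₄) →
          v₁ ≠ v₂ → v₁ ≠ v₃ → v₁ ≠ v₄ → v₂ ≠ v₃ → v₂ ≠ v₄ → v₃ ≠ v₄ → False) ∨
      (∃ (v : Fin n) (S : Set (Fin n)), (b ≠ v → b ∈ S) ∧ (c ≠ v → c ∈ S) ∧
          (∀ u x, u ∈ S → H.Adj u x → x ∉ K → x ≠ v → x ∈ S) ∧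
          (∀ y, y ∈ S → y ≠ b → y ≠ c → (∃ k, k ∈ K ∧ H.Adj k y) → False))) :
    clusterSquare w a b c ≤ (prodBernoulli w).real (openConn b c)ᶜ ^ 2 :=
  clusterSquare_le_sq_of_noQuadClash_pos w a b c fun _ _ hω hη hab hac hbc hbc' =>
    not_quadClash_of_gate H w hH hK hω hη hab hac hbc hbc'

/-- **DUU at `(a; b, c)` under the same hypothesis.** [cite: Gladkov2024, Thm. 5.2 and Thm. 4.3; derived here] -/
theorem sq_real_split_le_of_gate {n : ℕ} (w : Sym2 (Fin n) → unitInterval) (a b c : Fin n) (H : SimpleGraph (Fin n))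
    (hH : ∀ u v, u ≠ v → (0 : ℝ) < w s(u, v) → H.Adj u v)
    (hK : ∀ (K : Set (Fin n)), a ∈ K → b ∉ K → c ∉ K →
      (∀ T : Set (Fin n), a ∈ T → (∀ u x, u ∈ T → H.Adj u x → x ∈ K → x ∈ T) → K ⊆ T) →
      (∀ v₁ v₂ v₃ v₄ : Fin n, v₁ ∉ K → v₂ ∉ K → v₃ ∉ K → v₄ ∉ K →
          (∃ k, k ∈ K ∧ H.Adj k v₁) → (∃ k, k ∈ K ∧ H.Adj k v₂) → (∃ k, k ∈ K ∧ H.Adj k v₃) → (∃ k, k ∈ K ∧ H.Adj k v₄) →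
          v₁ ≠ v₂ → v₁ ≠ v₃ → v₁ ≠ v₄ → v₂ ≠ v₃ → v₂ ≠ v₄ → v₃ ≠ v₄ → False) ∨
      (∃ (v : Fin n) (S : Set (Fin n)), (b ≠ v → b ∈ S) ∧ (c ≠ v → c ∈ S) ∧
          (∀ u x, u ∈ S → H.Adj u x → x ∉ K → x ≠ v → x ∈ S) ∧
          (∀ y, y ∈ S → y ≠ b → y ≠ c → (∃ k, k ∈ K ∧ H.Adj k y) → False))) :
    (prodBernoulli w).real ((openConn a b)ᶜ ∩ (openConn a c)ᶜ ∩ (openConn b c)ᶜ) ^ 2 ≤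
      (prodBernoulli w).real ((openConn a b)ᶜ ∩ (openConn a c)ᶜ) * (prodBernoulli w).real (openConn b c)ᶜ ^ 2 :=
  sq_real_split_le_of_noQuadClash_pos w a b c fun _ _ hω hη hab hac hbc hbc' =>
    not_quadClash_of_gate H w hH hK hω hη hab hac hbc hbc'

end Consts

end Summit.CriticalPhenomena.PercolationContinuityZ3.Theorems
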